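/-
Copyright (c) 2026. All rights reserved.
Released under Apache 2.0 license as described in the file LICENSE.
Authors: HodgeCM publication cell (pub-hodgecm), model-construction sub-cell, construction prover `mc-theta-1` (gen 3).
-/
import Literature.Analysis.SegalBargmann.SchwartzMetaplecticGenerators
import Literature.Analysis.Distribution.SchwartzLinearFlowEstimates
import Mathlib.Analysis.Normed.Module.FiniteDimension
import HarnessLib

/-!
# Joint continuity of linear changes of variables and of Levi families on Schwartz space

Topic `Analysis/SegalBargmann`; namespace `Literature.Analysis.SegalBargmann`.  KERNEL ONLY (0 records).

Let `E`, `F` be real normed spaces.  For a family of linear automorphisms `M : X → (E ≃L[ℝ] E)` indexed by a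
topological space `X` and continuous in operator norm, the composition action on Schwartz space is **jointly
continuous**:

* `continuousAt_compCLM_uncurry`, `continuous_compCLM_uncurry` —
  `(x, Φ) ↦ Φ ∘ M x : X × 𝓢(E, F) → 𝓢(E, F)` is continuous (in the Schwartz topology); in particular every orbit
  map `x ↦ Φ ∘ M x` is (`continuous_compCLM_apply`).  The engine is the estimate
  `p_{k,n}(Ψ ∘ L − Ψ) = O(‖L − 1‖)` of `SchwartzLinearFlowEstimates.seminorm_compCLM_sub_le` at the base point,
  after the factorisation `Φ ∘ M x = (Φ ∘ M x₀) ∘ (M x₀)⁻¹ M x`; no group law and no completeness is used.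
* `continuous_leviFactor` — `a ↦ |det a|^{-1/2}` is continuous along any family whose inverses are continuous in
  operator norm; `continuous_leviS_uncurry`, `continuous_leviS_apply` — the **Levi operators
  `leviS a : f ↦ |det a|^{-1/2} f ∘ a⁻¹`** of `SchwartzMetaplecticGenerators` ([Folland1989, (4.24)]) are jointly /
  strongly continuous along such a family: for a one-parameter subgroup `t ↦ a_t` of `GL(ℝ^σ)` this is the
  statement that the Levi part of the metaplectic (oscillator) representation acts continuously on its space of
  smooth vectors `𝓢(ℝ^σ)` (G. B. Folland, *Harmonic Analysis in Phase Space*, Ch. 4 §2 [Folland1989]; the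
  Schwartz space as the smooth vectors: [ReedSimonI1980, §V.3]) — the "A-part" input of a `KAK` continuity
  argument for the archimedean Weil representation of a real-rank-one unitary group.

All statements are elementary real analysis; we know no reference stating them in this form (`folklore`).

References: [Folland1989] Ch. 4 §2 (4.24); [ReedSimonI1980] §V.3.
-/

set_option autoImplicit false

noncomputable section

open Filter Topology SchwartzMap
open scoped SchwartzMap

namespace Literature.Analysis.SegalBargmann

open Literature.Analysis.Distribution

/-! ## 1. Joint continuity of `(L, Φ) ↦ Φ ∘ L` -/

section CompCLM

variable {E F : Type*} [NormedAddCommGroup E] [NormedSpace ℝ E] [NormedAddCommGroup F] [NormedSpace ℝ F]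
  (𝕜 : Type*) [RCLike 𝕜] [NormedSpace 𝕜 F] [SMulCommClass ℝ 𝕜 F] {X : Type*}

/-- **Continuity at the identity, jointly in the function**: if `N x → 1` in operator norm along a filter `l`,
then `(N x, Ψ) ↦ Ψ ∘ N x` tends to `Ψ₀` along `l ×ˢ 𝓝 Ψ₀`.  Quantitative input:
`SchwartzLinearFlowEstimates.seminorm_compCLM_sub_le`. [folklore] -/
theorem tendsto_compCLM_of_tendsto_one {l : Filter X} {N : X → (E ≃L[ℝ] E)}
    (hN : Tendsto (fun x => (N x : E →L[ℝ] E)) l (𝓝 1)) (Ψ₀ : 𝓢(E, F)) :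
    Tendsto (fun p : X × 𝓢(E, F) => compCLMOfContinuousLinearEquiv 𝕜 (N p.1) p.2) (l ×ˢ 𝓝 Ψ₀) (𝓝 Ψ₀) := by
  rw [(schwartz_withSeminorms ℝ E F).tendsto_nhds]
  rintro ⟨k, n⟩ ε hε
  rw [schwartzSeminormFamily_apply]
  -- constants at the base point
  set A : ℝ := 2 ^ (n + k + 1) with hA
  set B : ℝ := n * 2 ^ n with hB
  have hA0 : 0 ≤ A := by positivity
  have hB0 : 0 ≤ B := by positivity
  set C₀ : ℝ := A * (SchwartzMap.seminorm ℝ (k + 1) (n + 1) Ψ₀ + 1) + B * (SchwartzMap.seminorm ℝ k n Ψ₀ + 1)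
    with hC₀
  have hC₀0 : 0 ≤ C₀ := by positivity
  set η : ℝ := min (1 / 2) (ε / (2 * (C₀ + 1))) with hη
  have hη0 : 0 < η := lt_min (by norm_num) (by positivity)
  -- eventually `‖N x - 1‖ < η`
  have h1 : ∀ᶠ x in l, ‖(N x : E →L[ℝ] E) - 1‖ < η := by
    have := (tendsto_iff_norm_sub_tendsto_zero.1 hN)
    exact (this.eventually (gt_mem_nhds hη0))
  -- eventually the seminorms of `Ψ - Ψ₀` are small
  have hc1 : Continuous fun Ψ : 𝓢(E, F) => SchwartzMap.seminorm ℝ (k + 1) (n + 1) (Ψ - Ψ₀) :=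
    ((schwartz_withSeminorms ℝ E F).continuous_seminorm (k + 1, n + 1)).comp (continuous_id.sub continuous_const)
  have hc2 : Continuous fun Ψ : 𝓢(E, F) => SchwartzMap.seminorm ℝ k n (Ψ - Ψ₀) :=
    ((schwartz_withSeminorms ℝ E F).continuous_seminorm (k, n)).comp (continuous_id.sub continuous_const)
  have h2 : ∀ᶠ Ψ in 𝓝 Ψ₀, SchwartzMap.seminorm ℝ (k + 1) (n + 1) (Ψ - Ψ₀) < 1 := by
    have := hc1.tendsto Ψ₀
    simp only [sub_self, map_zero] at this
    exact this.eventually (gt_mem_nhds one_pos)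
  have h3 : ∀ᶠ Ψ in 𝓝 Ψ₀, SchwartzMap.seminorm ℝ k n (Ψ - Ψ₀) < min 1 (ε / 2) := by
    have := hc2.tendsto Ψ₀
    simp only [sub_self, map_zero] at this
    exact this.eventually (gt_mem_nhds (lt_min one_pos (half_pos hε)))
  filter_upwards [h1.prod_mk (h2.and h3)] with p hp
  obtain ⟨hx, hΨ1, hΨ2⟩ := hp
  set Ψ := p.2
  have hx2 : ‖(N p.1 : E →L[ℝ] E) - 1‖ ≤ 1 / 2 := hx.le.trans (min_le_left _ _)
  have hxη : ‖(N p.1 : E →L[ℝ] E) - 1‖ ≤ ε / (2 * (C₀ + 1)) := hx.le.trans (min_le_right _ _)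
  -- seminorms of `Ψ` are controlled by those of `Ψ₀`
  have hs1 : SchwartzMap.seminorm ℝ (k + 1) (n + 1) Ψ ≤ SchwartzMap.seminorm ℝ (k + 1) (n + 1) Ψ₀ + 1 := by
    have h' : SchwartzMap.seminorm ℝ (k + 1) (n + 1) Ψ ≤
        SchwartzMap.seminorm ℝ (k + 1) (n + 1) Ψ₀ + SchwartzMap.seminorm ℝ (k + 1) (n + 1) (Ψ - Ψ₀) := by
      calc SchwartzMap.seminorm ℝ (k + 1) (n + 1) Ψ
          = SchwartzMap.seminorm ℝ (k + 1) (n + 1) (Ψ₀ + (Ψ - Ψ₀)) := by rw [add_sub_cancel]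
        _ ≤ _ := map_add_le_add _ _ _
    linarith [hΨ1]
  have hs2 : SchwartzMap.seminorm ℝ k n Ψ ≤ SchwartzMap.seminorm ℝ k n Ψ₀ + 1 := by
    have h' : SchwartzMap.seminorm ℝ k n Ψ ≤ SchwartzMap.seminorm ℝ k n Ψ₀ + SchwartzMap.seminorm ℝ k n (Ψ - Ψ₀) := by
      calc SchwartzMap.seminorm ℝ k n Ψ = SchwartzMap.seminorm ℝ k n (Ψ₀ + (Ψ - Ψ₀)) := by rw [add_sub_cancel]
        _ ≤ _ := map_add_le_add _ _ _
    linarith [hΨ2.trans_le (min_le_left _ _)]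
  -- the estimate at the identity
  have hkey := seminorm_compCLM_sub_le (Φ := Ψ) 𝕜 (N p.1) hx2 k n
  have hcoef : (2 ^ (n + k + 1) * SchwartzMap.seminorm ℝ (k + 1) (n + 1) Ψ
      + n * 2 ^ n * SchwartzMap.seminorm ℝ k n Ψ) ≤ C₀ := by
    rw [hC₀]
    have e1 : (2 : ℝ) ^ (n + k + 1) * SchwartzMap.seminorm ℝ (k + 1) (n + 1) Ψ ≤
        A * (SchwartzMap.seminorm ℝ (k + 1) (n + 1) Ψ₀ + 1) := by
      rw [hA]; exact mul_le_mul_of_nonneg_left hs1 (by positivity)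
    have e2 : (n : ℝ) * 2 ^ n * SchwartzMap.seminorm ℝ k n Ψ ≤ B * (SchwartzMap.seminorm ℝ k n Ψ₀ + 1) := by
      rw [hB]; exact mul_le_mul_of_nonneg_left hs2 (by positivity)
    linarith
  have hfirst : SchwartzMap.seminorm ℝ k n (compCLMOfContinuousLinearEquiv 𝕜 (N p.1) Ψ - Ψ) ≤ ε / 2 := by
    refine hkey.trans ?_
    calc (2 ^ (n + k + 1) * SchwartzMap.seminorm ℝ (k + 1) (n + 1) Ψ + n * 2 ^ n * SchwartzMap.seminorm ℝ k n Ψ)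
          * ‖(N p.1 : E →L[ℝ] E) - 1‖
        ≤ C₀ * (ε / (2 * (C₀ + 1))) :=
          mul_le_mul hcoef hxη (norm_nonneg _) hC₀0
      _ ≤ (C₀ + 1) * (ε / (2 * (C₀ + 1))) := mul_le_mul_of_nonneg_right (by linarith) (by positivity)
      _ = ε / 2 := by
          have hC1 : (C₀ + 1) ≠ 0 := by positivity
          rw [mul_comm, div_mul_eq_mul_div, mul_div_mul_right _ _ hC1]
  calc SchwartzMap.seminorm ℝ k n (compCLMOfContinuousLinearEquiv 𝕜 (N p.1) Ψ - Ψ₀)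
      = SchwartzMap.seminorm ℝ k n ((compCLMOfContinuousLinearEquiv 𝕜 (N p.1) Ψ - Ψ) + (Ψ - Ψ₀)) := by
        rw [sub_add_sub_cancel]
    _ ≤ SchwartzMap.seminorm ℝ k n (compCLMOfContinuousLinearEquiv 𝕜 (N p.1) Ψ - Ψ)
        + SchwartzMap.seminorm ℝ k n (Ψ - Ψ₀) := map_add_le_add _ _ _
    _ < ε / 2 + ε / 2 := add_lt_add_of_le_of_lt hfirst (hΨ2.trans_le (min_le_right _ _))
    _ = ε := add_halves ε

omit [SMulCommClass ℝ 𝕜 F] in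
/-- the factorisation `Φ ∘ M x = (Φ ∘ M x₀) ∘ ((M x₀)⁻¹ ∘ M x)`. [folklore] -/
theorem compCLM_eq_compCLM_trans_symm (M₀ M : E ≃L[ℝ] E) (Φ : 𝓢(E, F)) :
    compCLMOfContinuousLinearEquiv 𝕜 M Φ =
      compCLMOfContinuousLinearEquiv 𝕜 (M.trans M₀.symm) (compCLMOfContinuousLinearEquiv 𝕜 M₀ Φ) := by
  ext v
  simp only [compCLMOfContinuousLinearEquiv_apply, Function.comp_apply, ContinuousLinearEquiv.trans_apply,
    ContinuousLinearEquiv.apply_symm_apply]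

/-- **Joint continuity of `(x, Φ) ↦ Φ ∘ M x` at a point** where `x ↦ M x` is operator-norm continuous. [folklore] -/
theorem continuousAt_compCLM_uncurry [TopologicalSpace X] {M : X → (E ≃L[ℝ] E)} {x₀ : X}
    (hM : ContinuousAt (fun x => (M x : E →L[ℝ] E)) x₀) (Φ₀ : 𝓢(E, F)) :
    ContinuousAt (fun p : X × 𝓢(E, F) => compCLMOfContinuousLinearEquiv 𝕜 (M p.1) p.2) (x₀, Φ₀) := by
  -- `N x := (M x₀)⁻¹ ∘ M x → 1`
  have hN : Tendsto (fun x => ((M x).trans (M x₀).symm : E →L[ℝ] E)) (𝓝 x₀) (𝓝 1) := by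
    have hcomp : ContinuousAt (fun x => ((M x₀).symm : E →L[ℝ] E).comp (M x : E →L[ℝ] E)) x₀ :=
      ContinuousAt.clm_comp continuousAt_const hM
    have h1 : ((M x₀).symm : E →L[ℝ] E).comp (M x₀ : E →L[ℝ] E) = 1 := by
      ext v; simp
    have : (fun x => ((M x).trans (M x₀).symm : E →L[ℝ] E)) =
        fun x => ((M x₀).symm : E →L[ℝ] E).comp (M x : E →L[ℝ] E) := by
      funext x; ext v; rfl
    rw [this, ← h1]
    exact hcomp
  have hT := tendsto_compCLM_of_tendsto_one 𝕜 hN (compCLMOfContinuousLinearEquiv 𝕜 (M x₀) Φ₀)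
  -- feed `p ↦ (p.1, Φ ∘ M x₀)`
  have hfeed : Tendsto (fun p : X × 𝓢(E, F) => (p.1, compCLMOfContinuousLinearEquiv 𝕜 (M x₀) p.2))
      (𝓝 (x₀, Φ₀)) (𝓝 x₀ ×ˢ 𝓝 (compCLMOfContinuousLinearEquiv 𝕜 (M x₀) Φ₀)) := by
    rw [nhds_prod_eq]
    exact tendsto_fst.prodMk
      (((compCLMOfContinuousLinearEquiv 𝕜 (M x₀)).continuous.tendsto Φ₀).comp tendsto_snd)
  have := hT.comp hfeed
  refine (this.congr fun p => ?_)
  exact (compCLM_eq_compCLM_trans_symm 𝕜 (M x₀) (M p.1) p.2).symm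

/-- **Joint continuity of `(x, Φ) ↦ Φ ∘ M x`** for an operator-norm continuous family `M`. [folklore] -/
theorem continuous_compCLM_uncurry [TopologicalSpace X] {M : X → (E ≃L[ℝ] E)}
    (hM : Continuous fun x => (M x : E →L[ℝ] E)) :
    Continuous fun p : X × 𝓢(E, F) => compCLMOfContinuousLinearEquiv 𝕜 (M p.1) p.2 :=
  continuous_iff_continuousAt.2 fun p => by
    simpa only [Prod.mk.eta] using continuousAt_compCLM_uncurry 𝕜 (hM.continuousAt (x := p.1)) p.2

/-- **Strong continuity**: every orbit map `x ↦ Φ ∘ M x` is continuous. [folklore] -/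
theorem continuous_compCLM_apply [TopologicalSpace X] {M : X → (E ≃L[ℝ] E)}
    (hM : Continuous fun x => (M x : E →L[ℝ] E)) (Φ : 𝓢(E, F)) :
    Continuous fun x => compCLMOfContinuousLinearEquiv 𝕜 (M x) Φ :=
  (continuous_compCLM_uncurry 𝕜 hM).uncurry_right Φ

end CompCLM

/-! ## 2. Levi families -/

section Levi

variable {σ : Type*} [Fintype σ] {X : Type*} [TopologicalSpace X]

/-- `|det a|^{-1/2} = |det a⁻¹|^{1/2}` with `a⁻¹` as a continuous linear map. [folklore] -/
theorem leviFactor_eq_rpow_det_symm (a : (σ → ℝ) ≃ₗ[ℝ] (σ → ℝ)) :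
    leviFactor a = ((|((a.symm.toContinuousLinearEquiv : (σ → ℝ) ≃L[ℝ] (σ → ℝ)) : (σ → ℝ) →L[ℝ] (σ → ℝ)).det|
      ^ (1 / 2 : ℝ) : ℝ) : ℂ) := by
  rw [leviFactor]
  congr 1
  have hdet : ((a.symm.toContinuousLinearEquiv : (σ → ℝ) ≃L[ℝ] (σ → ℝ)) : (σ → ℝ) →L[ℝ] (σ → ℝ)).det =
      (LinearMap.det (a : (σ → ℝ) →ₗ[ℝ] (σ → ℝ)))⁻¹ := by
    rw [ContinuousLinearMap.det, ← LinearEquiv.det_coe_symm]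
    rfl
  rw [hdet, abs_inv, Real.inv_rpow (abs_nonneg _), Real.rpow_neg (abs_nonneg _), one_div]

/-- **`x ↦ |det (a x)|^{-1/2}` is continuous** when the inverses `(a x)⁻¹` are operator-norm continuous. [folklore] -/
theorem continuous_leviFactor {a : X → ((σ → ℝ) ≃ₗ[ℝ] (σ → ℝ))}
    (ha : Continuous fun x => (((a x).symm.toContinuousLinearEquiv : (σ → ℝ) ≃L[ℝ] (σ → ℝ)) :
      (σ → ℝ) →L[ℝ] (σ → ℝ))) :
    Continuous fun x => leviFactor (a x) := by
  simp only [leviFactor_eq_rpow_det_symm]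
  exact Complex.continuous_ofReal.comp
    (((Real.continuous_rpow_const (by norm_num)).comp
      (continuous_abs.comp (ContinuousLinearMap.continuous_det.comp ha))))

/-- **Joint continuity of Levi families**: `(x, f) ↦ leviS (a x) f` is continuous when `x ↦ (a x)⁻¹` is
operator-norm continuous. [cite: Folland1989, (4.24)] [folklore] -/
theorem continuous_leviS_uncurry {a : X → ((σ → ℝ) ≃ₗ[ℝ] (σ → ℝ))}
    (ha : Continuous fun x => (((a x).symm.toContinuousLinearEquiv : (σ → ℝ) ≃L[ℝ] (σ → ℝ)) :
      (σ → ℝ) →L[ℝ] (σ → ℝ))) :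
    Continuous fun p : X × SchwartzMap (σ → ℝ) ℂ => leviS (a p.1) p.2 := by
  have h1 : Continuous fun p : X × SchwartzMap (σ → ℝ) ℂ =>
      compCLMOfContinuousLinearEquiv ℂ ((a p.1).symm.toContinuousLinearEquiv) p.2 :=
    continuous_compCLM_uncurry (E := σ → ℝ) (F := ℂ) ℂ (M := fun x => (a x).symm.toContinuousLinearEquiv) ha
  have h2 : Continuous fun p : X × SchwartzMap (σ → ℝ) ℂ => leviFactor (a p.1) :=
    (continuous_leviFactor ha).comp continuous_fst
  show Continuous fun p : X × SchwartzMap (σ → ℝ) ℂ =>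
    leviFactor (a p.1) • compCLMOfContinuousLinearEquiv ℂ ((a p.1).symm.toContinuousLinearEquiv) p.2
  exact h2.smul h1

/-- **Strong continuity of Levi families**: `x ↦ leviS (a x) f`. [cite: Folland1989, (4.24)] [folklore] -/
theorem continuous_leviS_apply {a : X → ((σ → ℝ) ≃ₗ[ℝ] (σ → ℝ))}
    (ha : Continuous fun x => (((a x).symm.toContinuousLinearEquiv : (σ → ℝ) ≃L[ℝ] (σ → ℝ)) :
      (σ → ℝ) →L[ℝ] (σ → ℝ))) (f : SchwartzMap (σ → ℝ) ℂ) :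
    Continuous fun x => leviS (a x) f :=
  (continuous_leviS_uncurry ha).uncurry_right f

end Levi

end Literature.Analysis.SegalBargmann

end
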